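import Mathlib
import HarnessLib
import Literature.Analysis.InnerProduct.RitzValueQuadraticResidualBound

/-!
# Quadratic residual bounds for clustered Ritz values from a NON-orthonormal frame
# (Stewart–Sun Thm V.3.12, frame / pencil form)

Topic `Literature/Analysis/InnerProduct`, namespace `Literature.Analysis.InnerProduct`; companion of
`RitzValueQuadraticResidualBound.lean` (Stewart–Sun Thm V.3.12 for an ISOMETRIC frame `X : F →ₗᵢ E`).
Cell certnum (CERTIFIED-NUMERICS STACK, D-0105 (6)), layer L4; typed at the request of seat
certnum-ila-2 (ila/DESIGN-ila-eig.md §3 K2 / §7 Q-eig-1: «the one MISSING decl = K2's composition for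
a non-orthonormal frame»).  HONEST FRAMING: a COROLLARY of the printed theorem (Stewart–Sun
Thm V.3.12, as proved in the tree with the sharper constant `√(1 − ρ²)`), obtained by applying it to
the isometric inclusion of the frame's RANGE; the corollary itself is not printed in [StewartSun1990]
— its docstring says so.  WHAT THIS IS NOT: not a floating-point statement; not an enclosure of the
pencil eigenvalues `μ_j` themselves (clients enclose them separately, e.g. by Ostrowski + Weyl,
`OstrowskiCongruence.lean`, `WeylEigenvalueInequalities.lean`); not the `sin Θ` bound for the frame.

THE STATEMENT (operator form `abs_pencil_sub_eigenvalues_le_sq_div_of_frame`).  `T` symmetric on `E`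
(`dim E = n`, eigenvalues `λ₀ ≥ ⋯ ≥ λ_{n−1}` = `hT.eigenvalues hn`); a frame `V : F →ₗ E` (`dim F = m`)
bounded below, `s ‖y‖ ≤ ‖V y‖` (`s > 0`; e.g. `s² = 1 − ε` when `‖V⋆V − 1‖ ≤ ε < 1`); an arbitrary
`D : F →ₗ F` (the matrix of approximate eigenvalues) with residual `‖T (V y) − V (D y)‖ ≤ r ‖y‖`;
a descending `V⋆V`-orthonormal eigen-decomposition `(μ, y_b)` of the pencil `(V⋆TV, V⋆V)` — typed in
weak form `⟪T (V y_i), V y'⟫ = μ_i ⟪V y_i, V y'⟫ ∀ y'`, `⟪V y_i, V y_j⟫ = δ_ij` (such data exist and the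
list `μ` is unique: `exists_basis_pencil_eigenvectors`, `pencil_eigenvalues_unique` in
`KahanEigenvaluePairing.lean`, coercivity constant `β = s²`); all `μ_j ∈ [a, b]`; an index set `I` of
exactly `m` indices with `λ_i ≤ a − δ` or `b + δ ≤ λ_i` for `i ∉ I` (`δ > 0`); and `η := r/s < δ`.
THEN `|μ_j − λ_{I(j)}| ≤ η² / (δ √(1 − (η/δ)²))` for every `j`.
PROOF.  `U := range V` (dimension `m`), `X := U ↪ E` (isometry), `M :=` the compression `P_U T|_U`
(symmetric, `⟪M z, w⟫ = ⟪T z, w⟫`).  The vectors `V y_i` form an orthonormal eigenbasis of `M` with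
eigenvalues `μ_i` (weak pencil equation ⇔ `T (V y_i) − μ_i V y_i ⊥ U`), so `μ` IS the Ritz list of
`(T, U)` (`eigenvalues_eq_of_orthonormalBasis`); and for `z = V y ∈ U`,
`T z − M z = (1 − P_U)(T (V y) − V (D y))` (because `V (D y) ∈ U`) has norm `≤ r ‖y‖ ≤ (r/s) ‖z‖`.
Now apply `abs_eigenvalues_sub_eigenvalues_le_sq_div_of_isometry`.
Matrix form (`Matrix.abs_pencil_sub_eigenvalues₀_le_sq_div_of_frame`): `A : Matrix ι ι 𝕜` Hermitian,
`V : Matrix ι l 𝕜`, `D : Matrix l l 𝕜`, sums-of-squares forms of the two norm hypotheses, the pencil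
`(Vᴴ A V, Vᴴ V)` with `(VᴴAV) y_i = μ_i (VᴴV) y_i`, `y_iᴴ (VᴴV) y_j = δ_ij`, conclusion for
`Matrix.IsHermitian.eigenvalues₀`.

AI-produced formalisation (cell certnum, seat certnum-lean-1, 2026-08-26).
-/

set_option autoImplicit false

noncomputable section

open scoped InnerProductSpace ComplexConjugate
open Module Finset

namespace Literature.Analysis.InnerProduct

variable {𝕜 : Type*} [RCLike 𝕜] {E : Type*} [NormedAddCommGroup E] [InnerProductSpace 𝕜 E]
  [FiniteDimensional 𝕜 E] {F : Type*} [NormedAddCommGroup F] [InnerProductSpace 𝕜 F]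
  [FiniteDimensional 𝕜 F] {T : E →ₗ[𝕜] E} {n m : ℕ}

/-- **Stewart–Sun Thm V.3.12 for a non-orthonormal frame (pencil form; corollary).**  See the module
docstring for the statement in words.  Hypotheses: `T` symmetric; `V : F →ₗ E` with `s ‖y‖ ≤ ‖V y‖`,
`s > 0`; `D : F →ₗ F` with `‖T (V y) − V (D y)‖ ≤ r ‖y‖`; `(μ, yb)` a descending eigen-decomposition of
the pencil `(V⋆TV, V⋆V)` in weak form, `V⋆V`-orthonormal; `μ_j ∈ [a, b]`; gap `δ > 0` separating the
other eigenvalues of `T` from `[a, b]` off an index set `I` with `|I| = m = dim F`; `r/s < δ`.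
Conclusion: `|μ_j − λ_{I(j)}(T)| ≤ (r/s)² / (δ √(1 − ((r/s)/δ)²))`.  This corollary is not printed in
the source; it is Thm V.3.12 (tree: `abs_eigenvalues_sub_eigenvalues_le_sq_div_of_isometry`, sharper
constant) applied to the isometric inclusion of `range V`.
[cite: StewartSun1990, Thm V.3.12] -/
theorem abs_pencil_sub_eigenvalues_le_sq_div_of_frame (hT : T.IsSymmetric) (hn : finrank 𝕜 E = n)
    (hm : finrank 𝕜 F = m) (V : F →ₗ[𝕜] E) (D : F →ₗ[𝕜] F) {s r : ℝ} (hs : 0 < s)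
    (hV : ∀ y, s * ‖y‖ ≤ ‖V y‖) (hres : ∀ y, ‖T (V y) - V (D y)‖ ≤ r * ‖y‖)
    {μ : Fin m → ℝ} {yb : Fin m → F} (hμ : Antitone μ)
    (hyb : ∀ i y', ⟪T (V (yb i)), V y'⟫_𝕜 = (μ i : 𝕜) * ⟪V (yb i), V y'⟫_𝕜)
    (hybB : ∀ i j, ⟪V (yb i), V (yb j)⟫_𝕜 = if i = j then 1 else 0)
    (I : Finset (Fin n)) (hI : I.card = m) {a b δ : ℝ} (hμ' : ∀ j, a ≤ μ j ∧ μ j ≤ b)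
    (hδ : 0 < δ) (hI' : ∀ i ∉ I, hT.eigenvalues hn i ≤ a - δ ∨ b + δ ≤ hT.eigenvalues hn i)
    (hηδ : r / s < δ) (j : Fin m) :
    |μ j - hT.eigenvalues hn (I.orderEmbOfFin hI j)| ≤
      (r / s) ^ 2 / (δ * Real.sqrt (1 - (r / s / δ) ^ 2)) := by
  classical
  rcases Nat.eq_zero_or_pos m with hm0 | hmpos
  · subst hm0; exact j.elim0
  haveI : Nontrivial F := Module.nontrivial_of_finrank_pos (R := 𝕜) (by rw [hm]; exact hmpos)
  -- `V` is injective; `U := range V` has dimension `m`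
  have hVinj : Function.Injective V := by
    refine (injective_iff_map_eq_zero V).2 fun y hy => ?_
    have h := hV y
    rw [hy, norm_zero] at h
    have : ‖y‖ ≤ 0 := by nlinarith [norm_nonneg y]
    exact norm_eq_zero.1 (le_antisymm this (norm_nonneg _))
  set U : Submodule 𝕜 E := LinearMap.range V with hU
  have hUm : finrank 𝕜 U = m := by rw [hU, LinearMap.finrank_range_of_inj hVinj, hm]
  have hVmem : ∀ y, V y ∈ U := fun y => LinearMap.mem_range_self V y
  -- `r ≥ 0`
  have hr : 0 ≤ r := by
    obtain ⟨y, hy⟩ := exists_ne (0 : F)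
    have h := (norm_nonneg _).trans (hres y)
    exact nonneg_of_mul_nonneg_left (by simpa using h) (norm_pos_iff.2 hy)
  -- the compression `M = P_U T|_U`
  set M : U →ₗ[𝕜] U := (U.orthogonalProjectionOnto : E →L[𝕜] U).toLinearMap ∘ₗ (T ∘ₗ U.subtype)
    with hM_def
  have hMcoe : ∀ z : U, ((M z : U) : E) = U.starProjection (T z) := fun z => by
    rw [hM_def, LinearMap.comp_apply, LinearMap.comp_apply, ContinuousLinearMap.coe_coe,
      Submodule.coe_orthogonalProjectionOnto_apply, Submodule.subtype_apply]
  have hMinner : ∀ z w : U, ⟪M z, w⟫_𝕜 = ⟪T (z : E), (w : E)⟫_𝕜 := fun z w => by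
    rw [Submodule.coe_inner, hMcoe, Submodule.inner_starProjection_left_eq_right,
      Submodule.starProjection_eq_self_iff.2 w.2]
  have hM : M.IsSymmetric := fun z w => by
    rw [hMinner, ← inner_conj_symm z (M w), hMinner w z, inner_conj_symm]
    exact hT _ _
  -- the isometric inclusion
  let X : U →ₗᵢ[𝕜] E := U.subtypeₗᵢ
  have hX : ∀ z : U, X z = (z : E) := fun z => rfl
  have hMX : ∀ z w : U, ⟪M z, w⟫_𝕜 = ⟪T (X z), X w⟫_𝕜 := fun z w => by rw [hX, hX, hMinner]
  -- residual of the compression: `‖T z − M z‖ ≤ (r/s) ‖z‖`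
  have hresM : ∀ z : U, ‖T (X z) - X (M z)‖ ≤ r / s * ‖z‖ := by
    intro z
    obtain ⟨y, hy⟩ : ∃ y, V y = (z : E) := LinearMap.mem_range.1 z.2
    have hw : T (X z) - X (M z) = (T (V y) - V (D y)) - U.starProjection (T (V y) - V (D y)) := by
      rw [hX, hX, hMcoe, ← hy, map_sub, Submodule.starProjection_eq_self_iff.2 (hVmem (D y))]
      abel
    have hPle : ‖(T (V y) - V (D y)) - U.starProjection (T (V y) - V (D y))‖ ≤ ‖T (V y) - V (D y)‖ := by
      have hpy := Submodule.norm_sq_eq_add_norm_sq_starProjection (T (V y) - V (D y)) U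
      rw [Submodule.starProjection_orthogonal_val] at hpy
      nlinarith [norm_nonneg ((T (V y) - V (D y)) - U.starProjection (T (V y) - V (D y))),
        norm_nonneg (T (V y) - V (D y)), norm_nonneg (U.starProjection (T (V y) - V (D y)))]
    have hzy : ‖y‖ ≤ ‖(z : E)‖ / s := by
      rw [le_div_iff₀ hs, mul_comm, ← hy]; exact hV y
    rw [hw]
    calc ‖(T (V y) - V (D y)) - U.starProjection (T (V y) - V (D y))‖ ≤ ‖T (V y) - V (D y)‖ := hPle
      _ ≤ r * ‖y‖ := hres y
      _ ≤ r * (‖(z : E)‖ / s) := mul_le_mul_of_nonneg_left hzy hr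
      _ = r / s * ‖z‖ := by rw [Submodule.coe_norm]; ring
  -- the Ritz list of `(T, U)` is `μ`: `V yb_i` is an orthonormal eigenbasis of `M`
  let u : Fin m → U := fun i => ⟨V (yb i), hVmem (yb i)⟩
  have hu_on : Orthonormal 𝕜 u := by
    rw [orthonormal_iff_ite]
    intro i j
    rw [Submodule.coe_inner]
    exact hybB i j
  have hutop : ⊤ ≤ Submodule.span 𝕜 (Set.range u) :=
    (hu_on.linearIndependent.span_eq_top_of_card_eq_finrank' (by rw [Fintype.card_fin, hUm])).ge
  let bU : OrthonormalBasis (Fin m) 𝕜 U := OrthonormalBasis.mk hu_on hutop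
  have hbU : ∀ i, bU i = u i := fun i => by simp [bU]
  have hMu : ∀ i, M (bU i) = (μ i : 𝕜) • bU i := by
    intro i
    rw [hbU]
    apply Subtype.ext
    rw [hMcoe, Submodule.coe_smul]
    -- `P_U (T (V yb_i)) = μ_i V yb_i`: the difference is orthogonal to `U = range V`
    refine Submodule.eq_starProjection_of_mem_orthogonal (Submodule.smul_mem U _ (hVmem (yb i))) ?_
    rw [Submodule.mem_orthogonal']
    intro w hw
    obtain ⟨y', rfl⟩ := LinearMap.mem_range.1 hw
    show ⟪T (V (yb i)) - (μ i : 𝕜) • V (yb i), V y'⟫_𝕜 = 0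
    rw [inner_sub_left, hyb i y', inner_smul_left, RCLike.conj_ofReal, sub_self]
  have hident : hM.eigenvalues hUm = μ := eigenvalues_eq_of_orthonormalBasis hM hUm bU μ hμ hMu
  -- apply Thm V.3.12 for the isometric frame `X`
  have hMb : ∀ j, a ≤ hM.eigenvalues hUm j ∧ hM.eigenvalues hUm j ≤ b := fun j => by
    rw [hident]; exact hμ' j
  have h := abs_eigenvalues_sub_eigenvalues_le_sq_div_of_isometry hT hn hM hUm X I hI hMX hMb hδ hI'
    hresM hηδ j
  rwa [hident] at h

/-! ### Hermitian matrices in coordinates (the form a verifier instantiates) -/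

section Matrix

open Matrix WithLp

variable {ι l : Type*} [Fintype ι] [DecidableEq ι] [Fintype l] [DecidableEq l]

/-- `⟪toEuclideanLin (Vᴴ A V) x, y⟫ = ⟪A (V x), V y⟫` (adapted from `RitzValueQuadraticResidualBound`).
[folklore] -/
private theorem inner_toEuclideanLin_conjTranspose_mul_mul'' (A : Matrix ι ι 𝕜) (V : Matrix ι l 𝕜)
    (x y : EuclideanSpace 𝕜 l) :
    ⟪toEuclideanLin (Vᴴ * A * V) x, y⟫_𝕜 =
      ⟪toEuclideanLin A (toEuclideanLin V x), toEuclideanLin V y⟫_𝕜 := by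
  classical
  rw [Matrix.mul_assoc, toLpLin_mul_same, LinearMap.comp_apply,
    Matrix.toEuclideanLin_conjTranspose_eq_adjoint, LinearMap.adjoint_inner_left, toLpLin_mul_same,
    LinearMap.comp_apply]

/-- `⟪toEuclideanLin (Vᴴ V) x, y⟫ = ⟪V x, V y⟫`. [folklore] -/
private theorem inner_toEuclideanLin_conjTranspose_mul_self'' (V : Matrix ι l 𝕜)
    (x y : EuclideanSpace 𝕜 l) :
    ⟪toEuclideanLin (Vᴴ * V) x, y⟫_𝕜 = ⟪toEuclideanLin V x, toEuclideanLin V y⟫_𝕜 := by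
  classical
  rw [toLpLin_mul_same, LinearMap.comp_apply, Matrix.toEuclideanLin_conjTranspose_eq_adjoint,
    LinearMap.adjoint_inner_left]

/-- The frame residual in coordinates: `A (V y) − V (D y) = (A V − V D) y`
(adapted from `RitzValueQuadraticResidualBound`). [folklore] -/
private theorem toEuclideanLin_frame_residual_eq'' (A : Matrix ι ι 𝕜) (V : Matrix ι l 𝕜)
    (D : Matrix l l 𝕜) (z : EuclideanSpace 𝕜 l) :
    toEuclideanLin A (toEuclideanLin V z) - toEuclideanLin V (toEuclideanLin D z) =
      toLp 2 ((A * V - V * D) *ᵥ ofLp z) := by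
  simp only [toLpLin_apply, Matrix.sub_mulVec, ← Matrix.mulVec_mulVec, toLp_sub]

omit [DecidableEq ι] in
/-- Lower frame bound in `EuclideanSpace` clothing: `s² Σ‖y_j‖² ≤ Σ‖(Vy)_i‖²` gives
`s ‖y‖ ≤ ‖V y‖`. [folklore] -/
private theorem frame_lower_euclidean (V : Matrix ι l 𝕜) {s : ℝ} (hs : 0 < s)
    (hV : ∀ y : l → 𝕜, s ^ 2 * ∑ j, ‖y j‖ ^ 2 ≤ ∑ i, ‖(V *ᵥ y) i‖ ^ 2)
    (y : EuclideanSpace 𝕜 l) : s * ‖y‖ ≤ ‖toEuclideanLin V y‖ := by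
  have h2 : (s * ‖y‖) ^ 2 ≤ ‖toEuclideanLin V y‖ ^ 2 := by
    rw [mul_pow, EuclideanSpace.norm_sq_eq, toLpLin_apply, EuclideanSpace.norm_sq_eq]
    exact hV (ofLp y)
  exact (pow_le_pow_iff_left₀ (mul_nonneg hs.le (norm_nonneg _)) (norm_nonneg _) two_ne_zero).1 h2

/-- Residual bound in `EuclideanSpace` clothing. [folklore] -/
private theorem frame_residual_euclidean (A : Matrix ι ι 𝕜) (V : Matrix ι l 𝕜) (D : Matrix l l 𝕜)
    {r : ℝ} (hr : 0 ≤ r)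
    (hres : ∀ y : l → 𝕜, ∑ i, ‖((A * V - V * D) *ᵥ y) i‖ ^ 2 ≤ r ^ 2 * ∑ j, ‖y j‖ ^ 2)
    (y : EuclideanSpace 𝕜 l) :
    ‖toEuclideanLin A (toEuclideanLin V y) - toEuclideanLin V (toEuclideanLin D y)‖ ≤ r * ‖y‖ := by
  refine (pow_le_pow_iff_left₀ (norm_nonneg _) (mul_nonneg hr (norm_nonneg _)) two_ne_zero).1 ?_
  rw [toEuclideanLin_frame_residual_eq'' A V D y, EuclideanSpace.norm_sq_eq, mul_pow,
    EuclideanSpace.norm_sq_eq]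
  exact hres (ofLp y)

/-- The pencil equation `(VᴴAV) y = μ (VᴴV) y` in weak (inner-product) form. [folklore] -/
private theorem pencil_weak_euclidean (A : Matrix ι ι 𝕜) (V : Matrix ι l 𝕜) {μ : ℝ} {y : l → 𝕜}
    (hy : (Vᴴ * A * V) *ᵥ y = (μ : 𝕜) • ((Vᴴ * V) *ᵥ y)) (y' : EuclideanSpace 𝕜 l) :
    ⟪toEuclideanLin A (toEuclideanLin V (toLp 2 y)), toEuclideanLin V y'⟫_𝕜 =
      (μ : 𝕜) * ⟪toEuclideanLin V (toLp 2 y), toEuclideanLin V y'⟫_𝕜 := by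
  have h1 : toEuclideanLin (Vᴴ * A * V) (toLp 2 y) = (μ : 𝕜) • toEuclideanLin (Vᴴ * V) (toLp 2 y) := by
    rw [toLpLin_toLp, toLpLin_toLp, ← toLp_smul]
    exact congrArg (toLp 2) (by simpa [Matrix.toLin'_apply, Matrix.mul_assoc] using hy)
  rw [← inner_toEuclideanLin_conjTranspose_mul_mul'', h1, inner_smul_left, RCLike.conj_ofReal,
    inner_toEuclideanLin_conjTranspose_mul_self'']

omit [DecidableEq ι] in
/-- Orthonormality of the Ritz vectors `V y_i` in `EuclideanSpace` clothing. [folklore] -/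
private theorem frame_inner_euclidean (V : Matrix ι l 𝕜) (y y' : l → 𝕜) :
    ⟪toEuclideanLin V (toLp 2 y), toEuclideanLin V (toLp 2 y')⟫_𝕜 = (V *ᵥ y') ⬝ᵥ star (V *ᵥ y) := by
  rw [toLpLin_toLp, toLpLin_toLp, EuclideanSpace.inner_toLp_toLp, Matrix.toLin'_apply,
    Matrix.toLin'_apply]

set_option maxHeartbeats 400000 in
/-- **Stewart–Sun Thm V.3.12 for a non-orthonormal frame, Hermitian matrices in coordinates
(corollary; descending enumeration `Matrix.IsHermitian.eigenvalues₀`).**  `A : Matrix ι ι 𝕜`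
Hermitian; a frame `V : Matrix ι l 𝕜` with `s² Σ_j ‖y_j‖² ≤ Σ_i ‖(V y)_i‖²` for all `y` (`s > 0`,
`s = σ_min(V)`; e.g. `s² = 1 − ε` if `‖VᴴV − 1‖₂ ≤ ε`); any `D : Matrix l l 𝕜` with
`Σ_i ‖((A V − V D) y)_i‖² ≤ r² Σ_j ‖y_j‖²` (`‖AV − VD‖₂ ≤ r`, `r ≥ 0`); a descending eigen-decomposition
`(μ, y)` of the `l × l` pencil `(Vᴴ A V, Vᴴ V)`: `(VᴴAV) y_i = μ_i (VᴴV) y_i`, with the Ritz vectors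
`V y_i` orthonormal, `(V y_i)ᴴ (V y_j) = δ_ij` (such data exist and `μ` is THE descending pencil
eigenvalue list, `KahanEigenvaluePairing.exists_basis_pencil_eigenvectors` / `pencil_eigenvalues_unique`);
`μ_j ∈ [a, b]`; an index set `I` of exactly `|l|` indices with `λ↓_i(A) ≤ a − δ` or `b + δ ≤ λ↓_i(A)`
for `i ∉ I` (`δ > 0`); and `r/s < δ`.  Then `|μ_j − λ↓_{I(j)}(A)| ≤ (r/s)² / (δ √(1 − ((r/s)/δ)²))`
for every `j` (`I(j)` = the `j`-th smallest element of `I`).  Not printed in this form in the source —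
it is Thm V.3.12 applied to the range of `V` (see `abs_pencil_sub_eigenvalues_le_sq_div_of_frame`).
[cite: StewartSun1990, Thm V.3.12] -/
theorem abs_pencil_sub_eigenvalues₀_le_sq_div_of_frame {A : Matrix ι ι 𝕜} (hA : A.IsHermitian)
    (V : Matrix ι l 𝕜) (D : Matrix l l 𝕜) {s r : ℝ} (hs : 0 < s) (hr : 0 ≤ r)
    (hV : ∀ y : l → 𝕜, s ^ 2 * ∑ j, ‖y j‖ ^ 2 ≤ ∑ i, ‖(V *ᵥ y) i‖ ^ 2)
    (hres : ∀ y : l → 𝕜, ∑ i, ‖((A * V - V * D) *ᵥ y) i‖ ^ 2 ≤ r ^ 2 * ∑ j, ‖y j‖ ^ 2)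
    {μ : Fin (Fintype.card l) → ℝ} {yb : Fin (Fintype.card l) → (l → 𝕜)} (hμ : Antitone μ)
    (hyb : ∀ i, (Vᴴ * A * V) *ᵥ yb i = (μ i : 𝕜) • ((Vᴴ * V) *ᵥ yb i))
    (hybB : ∀ i j, (V *ᵥ yb j) ⬝ᵥ star (V *ᵥ yb i) = if i = j then 1 else 0)
    (I : Finset (Fin (Fintype.card ι))) (hI : I.card = Fintype.card l) {a b δ : ℝ}
    (hμ' : ∀ j, a ≤ μ j ∧ μ j ≤ b) (hδ : 0 < δ)
    (hgap : ∀ i ∉ I, hA.eigenvalues₀ i ≤ a - δ ∨ b + δ ≤ hA.eigenvalues₀ i)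
    (hηδ : r / s < δ) (j : Fin (Fintype.card l)) :
    |μ j - hA.eigenvalues₀ (I.orderEmbOfFin hI j)| ≤
      (r / s) ^ 2 / (δ * Real.sqrt (1 - (r / s / δ) ^ 2)) := by
  classical
  let T : EuclideanSpace 𝕜 ι →ₗ[𝕜] EuclideanSpace 𝕜 ι := toEuclideanLin A
  have hT : T.IsSymmetric := isSymmetric_toEuclideanLin_iff.mpr hA
  let Vl : EuclideanSpace 𝕜 l →ₗ[𝕜] EuclideanSpace 𝕜 ι := toEuclideanLin V
  let Dl : EuclideanSpace 𝕜 l →ₗ[𝕜] EuclideanSpace 𝕜 l := toEuclideanLin D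
  let ybE : Fin (Fintype.card l) → EuclideanSpace 𝕜 l := fun i => toLp 2 (yb i)
  have hV' : ∀ y, s * ‖y‖ ≤ ‖Vl y‖ := frame_lower_euclidean V hs hV
  have hres' : ∀ y, ‖T (Vl y) - Vl (Dl y)‖ ≤ r * ‖y‖ := frame_residual_euclidean A V D hr hres
  have hybE : ∀ i y', ⟪T (Vl (ybE i)), Vl y'⟫_𝕜 = (μ i : 𝕜) * ⟪Vl (ybE i), Vl y'⟫_𝕜 :=
    fun i y' => pencil_weak_euclidean A V (hyb i) y'
  have hybBE : ∀ i j, ⟪Vl (ybE i), Vl (ybE j)⟫_𝕜 = if i = j then 1 else 0 := fun i j => by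
    rw [show ⟪Vl (ybE i), Vl (ybE j)⟫_𝕜 = (V *ᵥ yb j) ⬝ᵥ star (V *ᵥ yb i) from
      frame_inner_euclidean V (yb i) (yb j)]
    exact hybB i j
  exact abs_pencil_sub_eigenvalues_le_sq_div_of_frame hT finrank_euclideanSpace finrank_euclideanSpace
    Vl Dl hs hV' hres' hμ hybE hybBE I hI hμ' hδ hgap hηδ j

end Matrix

end Literature.Analysis.InnerProduct
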